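import Literature.AlgebraicGeometry.Motives.FamiliesVHSProofs
import Literature.AlgebraicGeometry.Motives.HodgeStructureExteriorPowerBourbakiPolarization
import Literature.LinearAlgebra.Alternating.ExteriorPowerBaseChange
import Mathlib.Algebra.Category.ModuleCat.ExteriorPower
import HarnessLib

/-!
# The exterior powers `⋀ᵈ 𝒱` of a local system and of the data of a polarized variation of Hodge structure

Topic `Literature/AlgebraicGeometry/Motives` (namespaces `Literature.AlgebraicGeometry.Motives.LocalSystem` and `….VHSData`), lane `lit-hodgefound`
(seat `p08`, row g55-#10).  DEFINITIONS WITH BODIES (`LocalSystem.exteriorPower`, the comparison maps `VHSData.ratInv` ∕ `exteriorPowerRatLinearMap`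
∕ `exteriorPowerRatIso`, and **`VHSData.exteriorPower`**) and their API; no named fact, no instance, no notation (D-0026 net debt `0`).

PRINTED SOURCES, VERBATIM.  E. Cattani, P. Deligne, A. Kaplan, *On the locus of Hodge classes*, J. AMS 8 (1995), proof of Cor. 1.4 (p. 486; held text
`paper:arxiv-alg-geom_9402009` p0002): «This amounts to `⋀ⁿ U_ℝ ⊂ ⋀ⁿ H_ℝ` being stable under `ℂ*`, i.e., to `⋀ⁿ U_ℚ` being a Hodge substructure of
`⋀ⁿ H_ℚ`, and reduces us to the one-dimensional case» — Cor. 1.3 is applied to the EXTERIOR-POWER VARIATION `⋀ⁿ 𝒱`, a polarizable variation of Hodge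
structure whose local system is `⋀ⁿ` of that of `𝒱`.  P. Deligne, *Équations différentielles à points singuliers réguliers*, LNM 163 (1970), I.1 (local
systems as functors on the fundamental groupoid; tensor operations fibrewise).  N. Bourbaki, *Algebra I*, Ch. III §7 no. 5 Prop. 8 («the canonical
extension `ψ : ⋀_B(B ⊗_A M) → B ⊗_A ⋀_A(M)` … is a graded `B`-algebra isomorphism»; free `M`: the tree's `exteriorPowerBaseChangeEquiv`) and *Algèbre*
Ch. 9 §1 no. 9 (37) (the form `Q_(d)(x₁ ∧ ⋯ ∧ x_d, y₁ ∧ ⋯ ∧ y_d) = det(Q(x_i, y_j))`: the tree's `bilinFormExteriorPower`, `Polarization.exteriorPowerDet`).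

* §1 **`LocalSystem.exteriorPower V d = V ⋙ ⋀ᵈ`** (Mathlib's `ModuleCat.exteriorPower.functor`): fibre `⋀ᵈ V_s`, transport `⋀ᵈ(γ·)`; compatible with
  `LocalSystem.comap`.
* §2 **`VHSData.finite_fiber`** — the rational fibres `V_s ≅ V_ℤ,s ⊗ ℚ` are finite dimensional (discharges the instance hypothesis
  `[∀ s, Module.Finite ℚ (D.V.fiber s)]` of `HodgeTheory/VHSDataSubHodgeStructureTranslateLocus`).
* §3 the comparison `ℚ ⊗ ⋀ᵈ_ℤ V_ℤ,s ⥲ ⋀ᵈ_ℚ V_s`, `1 ⊗ (m₁ ∧ ⋯ ∧ m_d) ↦ toRat m₁ ∧ ⋯ ∧ toRat m_d` (Bourbaki's base change of exterior powers composed with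
  `⋀ᵈ ratIso⁻¹`), an isomorphism (`V_ℤ,s` free), natural in `s` (**`exteriorPowerRatIso`**).
* §4 **`VHSData.exteriorPower D d : VHSData S (d·k)`** — local systems `⋀ᵈ V_ℤ`, `⋀ᵈ V`, comparison §3, Hodge structures `(D.hodge s).exteriorPower d`,
  polarizations Bourbaki's `Q_(d)` (`Polarization.exteriorPowerDet`), flat because transport is an isometry of `Q`
  (`bilinFormExteriorPower_map_map`); API: `exteriorPower_toRat_ιMulti` (`toRat(m₁ ∧ ⋯ ∧ m_d) = toRat m₁ ∧ ⋯ ∧ toRat m_d`),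
  `isHodgeAt_exteriorPower_ιMulti_iff`, `exteriorPower_V_transport`.

NOT HERE: holomorphy (as for every `VHSData`); the Lefschetz-type polarization of `⋀ᵈ` (the tree's `Polarization.exteriorPower`, odd weight).

## References

* [CattaniDeligneKaplan1995] E. Cattani, P. Deligne, A. Kaplan, *On the locus of Hodge classes*, J. Amer. Math. Soc. 8 (1995) 483–506: proof of
  Cor. 1.4 (p. 486).
* [Deligne1970] P. Deligne, *Équations différentielles à points singuliers réguliers*, LNM 163 (1970), I.1.
* [BourbakiAlgebraI1989] N. Bourbaki, *Algebra I, Chapters 1–3*, Springer 1989, Ch. III §7 no. 5 Prop. 8.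
* [BourbakiAlgebreIX2007] N. Bourbaki, *Algèbre, Chapitre 9*, §1 no. 9 (37).
* [Schmid1973] W. Schmid, *Variation of Hodge structure: the singularities of the period mapping*, Invent. Math. 22 (1973), §2.
-/

noncomputable section

open CategoryTheory
open scoped TensorProduct

namespace Literature.AlgebraicGeometry.Motives

universe u

/-! ## §1 Exterior powers of local systems -/

namespace LocalSystem

variable {R : Type u} [CommRing R] {S : Type u} [TopologicalSpace S]

/-- **The exterior power `⋀ᵈ V` of a local system** of `R`-modules: the composite of `V : Π₁(S) ⥤ Mod_R` with Mathlib's exterior-power functor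
`ModuleCat.exteriorPower.functor R d` (fibre `⋀ᵈ V_s`, transport `⋀ᵈ` of the transport; Deligne 1970 I.1: tensor operations on local systems are
performed fibrewise). [cite: Deligne1970, I.1] -/
def exteriorPower (V : LocalSystem R S) (d : ℕ) : LocalSystem R S :=
  V ⋙ ModuleCat.exteriorPower.functor R d

/-- The value of `⋀ᵈ V` at a point of the fundamental groupoid is `⋀ᵈ` of the value of `V`. [cite: Deligne1970, I.1] -/
@[simp] theorem exteriorPower_obj (V : LocalSystem R S) (d : ℕ) (x : FundamentalGroupoid S) :
    (V.exteriorPower d).obj x = ModuleCat.of R (⋀[R]^d (V.obj x)) := rfl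

/-- The fibre of `⋀ᵈ V` at `s` is `⋀ᵈ V_s`. [cite: Deligne1970, I.1] -/
theorem exteriorPower_fiber (V : LocalSystem R S) (d : ℕ) (s : S) : (V.exteriorPower d).fiber s = ModuleCat.of R (⋀[R]^d (V.fiber s)) := rfl

/-- `⋀ᵈ V` on morphisms is `⋀ᵈ` of `V` on morphisms. [cite: Deligne1970, I.1] -/
theorem exteriorPower_map_hom (V : LocalSystem R S) (d : ℕ) {x y : FundamentalGroupoid S} (g : x ⟶ y) :
    ((V.exteriorPower d).map g).hom = _root_.exteriorPower.map d (V.map g).hom := rfl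

/-- **Transport in `⋀ᵈ V` is `⋀ᵈ` of the transport in `V`**: `γ · (v₁ ∧ ⋯ ∧ v_d) = γ·v₁ ∧ ⋯ ∧ γ·v_d`. [cite: Deligne1970, I.1] -/
theorem exteriorPower_transport (V : LocalSystem R S) (d : ℕ) {s t : S} (γ : Path.Homotopic.Quotient s t) :
    (V.exteriorPower d).transport γ = _root_.exteriorPower.map d (V.transport γ) := rfl

/-- Transport of a pure wedge. [cite: Deligne1970, I.1] -/
theorem exteriorPower_transport_ιMulti (V : LocalSystem R S) (d : ℕ) {s t : S} (γ : Path.Homotopic.Quotient s t) (v : Fin d → V.fiber s) :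
    (V.exteriorPower d).transport γ (_root_.exteriorPower.ιMulti R d v) = _root_.exteriorPower.ιMulti R d (fun i => V.transport γ (v i)) :=
  _root_.exteriorPower.map_apply_ιMulti (V.transport γ) v

/-- `⋀ᵈ` commutes with pull-back of local systems (both are compositions of functors). [cite: Deligne1970, I.1] -/
theorem exteriorPower_comap {S' : Type u} [TopologicalSpace S'] (f : C(S', S)) (V : LocalSystem R S) (d : ℕ) :
    (V.comap f).exteriorPower d = (V.exteriorPower d).comap f := rfl

end LocalSystem

namespace VHSData

variable {S : Type} [TopologicalSpace S] {k : ℤ} (D : VHSData S k)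

/-! ## §2 The rational fibres are finite dimensional -/

/-- **The rational fibre `V_s` of a VHS datum is finite dimensional**: `V_s ≅ V_ℤ,s ⊗ ℚ` (`ratIso`) with `V_ℤ,s` finitely generated
(Schmid 1973 §2: `H_ℚ = H_ℤ ⊗ ℚ`, `H_ℤ` a lattice). [cite: Schmid1973, §2] -/
theorem finite_fiber (s : S) : Module.Finite ℚ (D.V.fiber s) := by
  haveI := D.finite s
  let e : ℚ ⊗[ℤ] (D.VZ.fiber s) ≃ₗ[ℚ] D.V.fiber s := (D.ratIso.app ⟨s⟩).toLinearEquiv.symm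
  exact Module.Finite.equiv e

/-! ## §3 The comparison `ℚ ⊗ ⋀ᵈ_ℤ V_ℤ,s ⥲ ⋀ᵈ_ℚ V_s` -/

/-- `ratIso⁻¹` at a point, read on the standard tensor product `ℚ ⊗_ℤ V_ℤ,x → V_x`. [cite: Schmid1973, §2] -/
def ratInv (x : FundamentalGroupoid S) : ℚ ⊗[ℤ] (D.VZ.obj x) →ₗ[ℚ] D.V.obj x :=
  (D.ratIso.inv.app x).hom

/-- `ratIso⁻¹(1 ⊗ u) = toRat u`. [cite: Schmid1973, §2] -/
theorem ratInv_one_tmul (x : FundamentalGroupoid S) (u : D.VZ.obj x) : D.ratInv x ((1 : ℚ) ⊗ₜ[ℤ] u) = D.toRat x.as u := rfl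

/-- **Naturality of `toRat` along every morphism of the fundamental groupoid** (the tree's `transport_toRat`, morphism form).
[cite: Schmid1973, §2] -/
theorem map_hom_toRat {x y : FundamentalGroupoid S} (g : x ⟶ y) (u : D.VZ.obj x) :
    (D.V.map g).hom (D.toRat x.as u) = D.toRat y.as ((D.VZ.map g).hom u) := by
  have h := congrArg (fun φ => φ.hom (D.oneTmul x.as u)) (D.ratIso.inv.naturality g)
  simp only [ModuleCat.hom_comp, LinearMap.comp_apply] at h
  rw [toRat_apply, toRat_apply, ← h]
  rfl

/-- **The comparison map `ℚ ⊗_ℤ ⋀ᵈ_ℤ V_ℤ,x → ⋀ᵈ_ℚ V_x`**: Bourbaki's base change `ℚ ⊗ ⋀ᵈ_ℤ M → ⋀ᵈ_ℚ(ℚ ⊗ M)` followed by `⋀ᵈ ratIso⁻¹`.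
[cite: BourbakiAlgebraI1989, Ch. III §7 no. 5 Prop. 8] -/
def exteriorPowerRatLinearMap (d : ℕ) (x : FundamentalGroupoid S) : ℚ ⊗[ℤ] (⋀[ℤ]^d (D.VZ.obj x)) →ₗ[ℚ] ⋀[ℚ]^d (D.V.obj x) :=
  _root_.exteriorPower.map d (D.ratInv x) ∘ₗ Literature.LinearAlgebra.Alternating.exteriorPowerBaseChange ℤ ℚ d (D.VZ.obj x)

/-- **`1 ⊗ (m₁ ∧ ⋯ ∧ m_d) ↦ toRat m₁ ∧ ⋯ ∧ toRat m_d`.** [cite: BourbakiAlgebraI1989, Ch. III §7 no. 5 Prop. 8] -/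
theorem exteriorPowerRatLinearMap_one_tmul_ιMulti (d : ℕ) (x : FundamentalGroupoid S) (m : Fin d → D.VZ.obj x) :
    D.exteriorPowerRatLinearMap d x ((1 : ℚ) ⊗ₜ[ℤ] _root_.exteriorPower.ιMulti ℤ d m) =
      _root_.exteriorPower.ιMulti ℚ d (fun i => D.toRat x.as (m i)) :=
  (congrArg (_root_.exteriorPower.map d (D.ratInv x))
      (Literature.LinearAlgebra.Alternating.exteriorPowerBaseChange_one_tmul_ιMulti ℤ ℚ m)).trans
    (_root_.exteriorPower.map_apply_ιMulti _ _)

/-- Two `ℚ`-linear maps out of `ℚ ⊗_ℤ N` agreeing on the `1 ⊗ y` are equal (the `1 ⊗ y` span over `ℚ`). [folklore] -/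
private theorem baseChange_linearMap_ext {N : Type} [AddCommGroup N] [Module ℤ N] {P : Type} [AddCommGroup P] [Module ℚ P]
    {g h : ℚ ⊗[ℤ] N →ₗ[ℚ] P} (H : ∀ y : N, g ((1 : ℚ) ⊗ₜ[ℤ] y) = h ((1 : ℚ) ⊗ₜ[ℤ] y)) : g = h := by
  refine TensorProduct.AlgebraTensorModule.ext fun a y => ?_
  have : (a ⊗ₜ[ℤ] y : ℚ ⊗[ℤ] N) = a • ((1 : ℚ) ⊗ₜ[ℤ] y) := by
    rw [TensorProduct.smul_tmul', smul_eq_mul, mul_one]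
  rw [this, map_smul, map_smul, H]

/-- Two `ℚ`-linear maps out of `ℚ ⊗_ℤ ⋀ᵈ_ℤ N` agreeing on the `1 ⊗ (m₁ ∧ ⋯ ∧ m_d)` are equal. [folklore] -/
private theorem baseChange_exteriorPower_linearMap_ext {N : Type} [AddCommGroup N] [Module ℤ N] {P : Type} [AddCommGroup P] [Module ℚ P]
    {d : ℕ} {g h : ℚ ⊗[ℤ] (⋀[ℤ]^d N) →ₗ[ℚ] P}
    (H : ∀ m : Fin d → N, g ((1 : ℚ) ⊗ₜ[ℤ] _root_.exteriorPower.ιMulti ℤ d m) = h ((1 : ℚ) ⊗ₜ[ℤ] _root_.exteriorPower.ιMulti ℤ d m)) :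
    g = h := by
  refine baseChange_linearMap_ext fun z => ?_
  have key : (g.restrictScalars ℤ) ∘ₗ TensorProduct.mk ℤ ℚ (⋀[ℤ]^d N) 1 = (h.restrictScalars ℤ) ∘ₗ TensorProduct.mk ℤ ℚ (⋀[ℤ]^d N) 1 :=
    _root_.exteriorPower.linearMap_ext (AlternatingMap.ext fun m => H m)
  exact LinearMap.congr_fun key z

/-- **Naturality of the comparison**: for `g : x ⟶ y` in `Π₁(S)`, `⋀ᵈ(V g) ∘ θ_x = θ_y ∘ (1 ⊗ ⋀ᵈ(V_ℤ g))` — on `1 ⊗ (m₁ ∧ ⋯ ∧ m_d)` both give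
`toRat(g·m₁) ∧ ⋯ ∧ toRat(g·m_d)` (naturality of `toRat`). [cite: BourbakiAlgebraI1989, Ch. III §7 no. 5 Prop. 8] [cite: Deligne1970, I.1] -/
theorem exteriorPowerRatLinearMap_naturality (d : ℕ) {x y : FundamentalGroupoid S} (g : x ⟶ y) :
    D.exteriorPowerRatLinearMap d y ∘ₗ (((D.VZ.exteriorPower d).map g).hom.baseChange ℚ) =
      _root_.exteriorPower.map d (D.V.map g).hom ∘ₗ D.exteriorPowerRatLinearMap d x := by
  refine baseChange_exteriorPower_linearMap_ext fun m => ?_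
  have h1 : (((D.VZ.exteriorPower d).map g).hom.baseChange ℚ) ((1 : ℚ) ⊗ₜ[ℤ] _root_.exteriorPower.ιMulti ℤ d m) =
      (1 : ℚ) ⊗ₜ[ℤ] _root_.exteriorPower.ιMulti ℤ d (fun i => (D.VZ.map g).hom (m i)) :=
    (LinearMap.baseChange_tmul _ _ _).trans (congrArg _ (_root_.exteriorPower.map_apply_ιMulti _ _))
  calc _ = D.exteriorPowerRatLinearMap d y
        ((((D.VZ.exteriorPower d).map g).hom.baseChange ℚ) ((1 : ℚ) ⊗ₜ[ℤ] _root_.exteriorPower.ιMulti ℤ d m)) := rfl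
    _ = D.exteriorPowerRatLinearMap d y ((1 : ℚ) ⊗ₜ[ℤ] _root_.exteriorPower.ιMulti ℤ d (fun i => (D.VZ.map g).hom (m i))) :=
        congrArg _ h1
    _ = _root_.exteriorPower.ιMulti ℚ d (fun i => D.toRat y.as ((D.VZ.map g).hom (m i))) :=
        D.exteriorPowerRatLinearMap_one_tmul_ιMulti d y _
    _ = _root_.exteriorPower.ιMulti ℚ d (fun i => (D.V.map g).hom (D.toRat x.as (m i))) := by
        congr 1
        funext i
        exact (D.map_hom_toRat g (m i)).symm
    _ = _root_.exteriorPower.map d (D.V.map g).hom (_root_.exteriorPower.ιMulti ℚ d (fun i => D.toRat x.as (m i))) :=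
        (_root_.exteriorPower.map_apply_ιMulti _ _).symm
    _ = _root_.exteriorPower.map d (D.V.map g).hom (D.exteriorPowerRatLinearMap d x ((1 : ℚ) ⊗ₜ[ℤ] _root_.exteriorPower.ιMulti ℤ d m)) := by
        rw [exteriorPowerRatLinearMap_one_tmul_ιMulti]

/-- The comparison map is bijective (`V_ℤ,x` is free: Bourbaki's Prop. 8, and `ratIso` is an isomorphism). [cite: BourbakiAlgebraI1989, Ch. III §7 no. 5 Prop. 8] -/
theorem exteriorPowerRatLinearMap_bijective (d : ℕ) (x : FundamentalGroupoid S) : Function.Bijective (D.exteriorPowerRatLinearMap d x) := by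
  haveI : Module.Free ℤ (D.VZ.obj x) := D.free x.as
  have hθ := Literature.LinearAlgebra.Alternating.exteriorPowerBaseChange_bijective ℤ ℚ (D.VZ.obj x) d
  -- `⋀ᵈ` of the linear equivalence `ratIso⁻¹` is bijective
  let e : ℚ ⊗[ℤ] (D.VZ.obj x) ≃ₗ[ℚ] D.V.obj x := (D.ratIso.app x).toLinearEquiv.symm
  have he : (e : ℚ ⊗[ℤ] (D.VZ.obj x) →ₗ[ℚ] D.V.obj x) = D.ratInv x := rfl
  have h1 : _root_.exteriorPower.map d (D.ratInv x) ∘ₗ _root_.exteriorPower.map d (e.symm : D.V.obj x →ₗ[ℚ] ℚ ⊗[ℤ] (D.VZ.obj x)) =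
      LinearMap.id := by
    rw [← he, ← _root_.exteriorPower.map_comp, LinearEquiv.comp_symm, _root_.exteriorPower.map_id]
  have h2 : _root_.exteriorPower.map d (e.symm : D.V.obj x →ₗ[ℚ] ℚ ⊗[ℤ] (D.VZ.obj x)) ∘ₗ _root_.exteriorPower.map d (D.ratInv x) =
      LinearMap.id := by
    rw [← he, ← _root_.exteriorPower.map_comp, LinearEquiv.symm_comp, _root_.exteriorPower.map_id]
  have hm : Function.Bijective (_root_.exteriorPower.map d (D.ratInv x)) :=
    ⟨Function.LeftInverse.injective (g := _root_.exteriorPower.map d (e.symm : D.V.obj x →ₗ[ℚ] ℚ ⊗[ℤ] (D.VZ.obj x)))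
        fun v => LinearMap.congr_fun h2 v,
      Function.RightInverse.surjective (g := _root_.exteriorPower.map d (e.symm : D.V.obj x →ₗ[ℚ] ℚ ⊗[ℤ] (D.VZ.obj x)))
        fun v => LinearMap.congr_fun h1 v⟩
  exact hm.comp hθ

/-- The comparison as a linear equivalence. [cite: BourbakiAlgebraI1989, Ch. III §7 no. 5 Prop. 8] -/
def exteriorPowerRatEquiv (d : ℕ) (x : FundamentalGroupoid S) : ℚ ⊗[ℤ] (⋀[ℤ]^d (D.VZ.obj x)) ≃ₗ[ℚ] ⋀[ℚ]^d (D.V.obj x) :=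
  LinearEquiv.ofBijective (D.exteriorPowerRatLinearMap d x) (D.exteriorPowerRatLinearMap_bijective d x)

/-- The component iso in `ModuleCat`: `(⋀ᵈ V_ℤ ⊗ ℚ)_x ≅ (⋀ᵈ V)_x`. [cite: BourbakiAlgebraI1989, Ch. III §7 no. 5 Prop. 8] -/
def exteriorPowerRatIsoApp (d : ℕ) (x : FundamentalGroupoid S) :
    ((D.VZ.exteriorPower d).baseChange (Int.castRingHom ℚ)).obj x ≅ (D.V.exteriorPower d).obj x :=
  LinearEquiv.toModuleIso (D.exteriorPowerRatEquiv d x)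

/-- Underlying map of the component iso. [cite: BourbakiAlgebraI1989, Ch. III §7 no. 5 Prop. 8] -/
theorem exteriorPowerRatIsoApp_hom_hom (d : ℕ) (x : FundamentalGroupoid S) :
    (D.exteriorPowerRatIsoApp d x).hom.hom = (D.exteriorPowerRatLinearMap d x :
      ((D.VZ.exteriorPower d).baseChange (Int.castRingHom ℚ)).obj x →ₗ[ℚ] (D.V.exteriorPower d).obj x) := rfl

/-- **The comparison isomorphism of local systems `⋀ᵈ V_ℤ ⊗ ℚ ≅ ⋀ᵈ V`** (natural in the point of `Π₁(S)`).
[cite: BourbakiAlgebraI1989, Ch. III §7 no. 5 Prop. 8] [cite: Deligne1970, I.1] -/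
def exteriorPowerRatIso (d : ℕ) : (D.VZ.exteriorPower d).baseChange (Int.castRingHom ℚ) ≅ D.V.exteriorPower d :=
  NatIso.ofComponents (fun x => D.exteriorPowerRatIsoApp d x) fun {x y} g => by
    ext1
    exact D.exteriorPowerRatLinearMap_naturality d g

/-! ## §4 The exterior power of a VHS datum -/

/-- **The exterior power `⋀ᵈ D` of the data of a polarized variation of Hodge structure** (the «exterior-power variation `⋀ᵈ 𝒱`» to which Cattani–
Deligne–Kaplan apply their Cor. 1.3 in the proof of Cor. 1.4): integral and rational local systems `⋀ᵈ V_ℤ`, `⋀ᵈ V`, comparison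
`⋀ᵈ V ≅ ⋀ᵈ V_ℤ ⊗ ℚ` (§3), on each fibre the Hodge structure `⋀ᵈ(V_s, F_s)` of weight `d·k` (`HodgeStructure.exteriorPower`) polarized by Bourbaki's
determinant form `Q_(d)` (`Polarization.exteriorPowerDet`), which is flat since parallel transport is a `Q`-isometry; the integral fibres
`⋀ᵈ V_ℤ,s` are finitely generated free. [cite: CattaniDeligneKaplan1995, proof of Cor. 1.4 (p. 486)] [cite: BourbakiAlgebreIX2007, §1 no. 9 (37)] -/
def exteriorPower (d : ℕ) : VHSData S (d * k) where
  VZ := D.VZ.exteriorPower d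
  V := D.V.exteriorPower d
  ratIso := (D.exteriorPowerRatIso d).symm
  hodge s := (D.hodge s).exteriorPower d
  form s :=
    haveI : Module.Finite ℚ (D.V.fiber s) := D.finite_fiber s
    (D.form s).exteriorPowerDet d
  transport_form s t γ x y := by
    haveI : Module.Finite ℚ (D.V.fiber s) := D.finite_fiber s
    haveI : Module.Finite ℚ (D.V.fiber t) := D.finite_fiber t
    change Literature.LinearAlgebra.Alternating.bilinFormExteriorPower (D.form t).form d
        (_root_.exteriorPower.map d (D.V.transport γ) x) (_root_.exteriorPower.map d (D.V.transport γ) y) =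
      Literature.LinearAlgebra.Alternating.bilinFormExteriorPower (D.form s).form d x y
    exact Literature.LinearAlgebra.Alternating.bilinFormExteriorPower_map_map d (D.transport_form s t γ) x y
  finite_free s := by
    haveI := D.finite s
    haveI := D.free s
    exact ⟨_root_.exteriorPower.instFinite, _root_.exteriorPower.instFree ℤ d⟩

variable (d : ℕ)

/-- The integral local system of `⋀ᵈ D` is `⋀ᵈ V_ℤ`. [cite: Deligne1970, I.1] -/
@[simp] theorem exteriorPower_VZ : (D.exteriorPower d).VZ = D.VZ.exteriorPower d := rfl

/-- The rational local system of `⋀ᵈ D` is `⋀ᵈ V`. [cite: Deligne1970, I.1] -/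
@[simp] theorem exteriorPower_V : (D.exteriorPower d).V = D.V.exteriorPower d := rfl

/-- The Hodge structure of `⋀ᵈ D` at `s` is `⋀ᵈ` of that of `D`. [cite: CattaniDeligneKaplan1995, proof of Cor. 1.4 (p. 486)] -/
@[simp] theorem exteriorPower_hodge (s : S) : (D.exteriorPower d).hodge s = (D.hodge s).exteriorPower d := rfl

/-- The polarization form of `⋀ᵈ D` at `s` is Bourbaki's `Q_(d)`: `Q_(d)(x₁ ∧ ⋯ ∧ x_d, y₁ ∧ ⋯ ∧ y_d) = det(Q_s(x_i, y_j))`.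
[cite: BourbakiAlgebreIX2007, §1 no. 9 (37)] -/
theorem exteriorPower_form_form (s : S) :
    ((D.exteriorPower d).form s).form = Literature.LinearAlgebra.Alternating.bilinFormExteriorPower (D.form s).form d := rfl

/-- Rational transport of `⋀ᵈ D` is `⋀ᵈ` of the transport of `D`. [cite: Deligne1970, I.1] -/
theorem exteriorPower_V_transport {s t : S} (γ : Path.Homotopic.Quotient s t) :
    (D.exteriorPower d).V.transport γ = _root_.exteriorPower.map d (D.V.transport γ) := rfl

/-- Integral transport of `⋀ᵈ D` is `⋀ᵈ` of the integral transport of `D`. [cite: Deligne1970, I.1] -/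
theorem exteriorPower_VZ_transport {s t : S} (γ : Path.Homotopic.Quotient s t) :
    (D.exteriorPower d).VZ.transport γ = _root_.exteriorPower.map d (D.VZ.transport γ) := rfl

/-- **`toRat(m₁ ∧ ⋯ ∧ m_d) = toRat m₁ ∧ ⋯ ∧ toRat m_d`**: the comparison `V_ℤ → V` of `⋀ᵈ D` on a pure wedge of integral vectors is the wedge of the
rational images. [cite: BourbakiAlgebraI1989, Ch. III §7 no. 5 Prop. 8] [cite: Schmid1973, §2] -/
theorem exteriorPower_toRat_ιMulti (s : S) (m : Fin d → D.VZ.fiber s) :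
    (D.exteriorPower d).toRat s (_root_.exteriorPower.ιMulti ℤ d m) = _root_.exteriorPower.ιMulti ℚ d (fun i => D.toRat s (m i)) :=
  D.exteriorPowerRatLinearMap_one_tmul_ιMulti d ⟨s⟩ m

/-- **Hodge classes of `⋀ᵈ D`**: the integral wedge `m₁ ∧ ⋯ ∧ m_d` is a Hodge class of level `P` at `s` for `⋀ᵈ D` iff
`toRat m₁ ∧ ⋯ ∧ toRat m_d ∈ Hdg^P(⋀ᵈ(V_s, F_s))`. [cite: CattaniDeligneKaplan1995, proof of Cor. 1.4 (p. 486)] -/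
theorem isHodgeAt_exteriorPower_ιMulti_iff (s : S) (P : ℤ) (m : Fin d → D.VZ.fiber s) :
    (D.exteriorPower d).IsHodgeAt s P (_root_.exteriorPower.ιMulti ℤ d m) ↔
      _root_.exteriorPower.ιMulti ℚ d (fun i => D.toRat s (m i)) ∈ ((D.hodge s).exteriorPower d).hodgeClasses P := by
  rw [IsHodgeAt, exteriorPower_toRat_ιMulti]
  rfl

/-- **Determinations in `⋀ᵈ D`**: the determination of `m₁ ∧ ⋯ ∧ m_d` along `γ` is of type `(P, P)` iff
`⋀ᵈ(γ·)(toRat m₁ ∧ ⋯ ∧ toRat m_d)` is a Hodge class of `⋀ᵈ(V_t, F_t)` — the right-hand side of `VHSData.translateLocus_eq_setOf_exteriorPower` (Cor. 1.4).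
[cite: CattaniDeligneKaplan1995, proof of Cor. 1.4 (p. 486)] -/
theorem isHodgeAt_exteriorPower_transport_ιMulti_iff {s t : S} (γ : Path.Homotopic.Quotient s t) (P : ℤ) (m : Fin d → D.VZ.fiber s) :
    (D.exteriorPower d).IsHodgeAt t P ((D.exteriorPower d).VZ.transport γ (_root_.exteriorPower.ιMulti ℤ d m)) ↔
      _root_.exteriorPower.map d (D.V.transport γ) (_root_.exteriorPower.ιMulti ℚ d fun i => D.toRat s (m i)) ∈
        ((D.hodge t).exteriorPower d).hodgeClasses P := by
  have h : (D.exteriorPower d).VZ.transport γ (_root_.exteriorPower.ιMulti ℤ d m) =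
      _root_.exteriorPower.ιMulti ℤ d (fun i => D.VZ.transport γ (m i)) :=
    D.VZ.exteriorPower_transport_ιMulti d γ m
  rw [h, isHodgeAt_exteriorPower_ιMulti_iff, _root_.exteriorPower.map_apply_ιMulti]
  simp only [Function.comp_def, transport_toRat]

end VHSData

end Literature.AlgebraicGeometry.Motives

end
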